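import Literature.NumberTheory.EllipticCurves.ModularFormsLevelFreeModule
import Literature.NumberTheory.EllipticCurves.ModularFormsGamma1PlusMinus
import HarnessLib

/-!
# `M(Γ) = ⊕ₖ M_k(Γ)` is free over `ℂ[E₄, E₆]` on at most `[SL₂(ℤ) : Γ]` generators for every
# finite-index level `Γ ∋ T` — the hypothesis `-1 ∈ Γ` of `ModularFormsLevelFreeModule` removed

`ModularFormsLevelFreeModule` proves that `M(Γ) = ⊕ₖ M_k(Γ)` is a free graded module over
`R = M(SL₂(ℤ)) = ℂ[E₄, E₆]` on `r ≤ [SL₂(ℤ) : Γ]` homogeneous generators (`Level.exists_isLevelBasis`)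
for a level `Γ ≤ SL₂(ℤ)` of finite index with `T ∈ Γ` **and `-1 ∈ Γ`**. The hypothesis `-1 ∈ Γ`
enters only the count `Level.card_genBelow_le` (through Sturm's bound with `d = [SL₂(ℤ) : Γ]` and the
vanishing of the odd weights). This file removes it, so that the structure theorem covers
`Γ = Γ₁(N)` itself (`N ≥ 3`, `-1 ∉ Γ₁(N)`), where the odd weights live:

* `Level.levelSpace_adjoinNegI_eq_of_even`: `M_k(±Γ) = M_k(Γ)` for even `k` (`±Γ = adjoinNegI Γ`);
  `Level.index_eq_two_mul_of_neg_one_not_mem`: `[SL₂(ℤ) : Γ] = 2[SL₂(ℤ) : ±Γ]` if `-1 ∉ Γ`.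
* **`Level.finrank_levelSpace_le_sharp`** — the sharp Sturm bound
  `dim M_k(Γ) ≤ ⌊k[SL₂(ℤ) : ±Γ]/12⌋ + 1` in *every* weight: for even `k` this is Sturm for `±Γ`;
  for odd `k`, if the first `⌊k[SL₂(ℤ):±Γ]/12⌋ + 1` coefficients of `f ∈ M_k(Γ)` vanish then
  `f² ∈ M_{2k}(Γ) = M_{2k}(±Γ)` vanishes at `∞` to order `> ⌊2k[SL₂(ℤ):±Γ]/12⌋`, so `f² = 0` by
  Sturm for `±Γ` (decay form, `coe_eq_zero_of_isBigO_exp'`), and `f = 0`.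
* `Level.card_genBelow_filter_le`: at most `[SL₂(ℤ) : ±Γ]` generators of each parity (the
  injection `⊕_j R_{M - k_j} ↪ M_M(Γ)` over the generators of the parity of `M`, against the sharp
  bound), hence **`Level.card_genBelow_le'`**: at most `[SL₂(ℤ) : Γ]` generators in all
  (`= [SL₂(ℤ):±Γ]` generators, all even, if `-1 ∈ Γ`; `= 2[SL₂(ℤ):±Γ]` otherwise);
* **`Level.exists_isLevelBasis'`**: a level-one basis `(F_i)_{i < r}` of `M(Γ)`, `r ≤ [SL₂(ℤ) : Γ]`,
  of weights `k_i ≥ 0` (of both parities), for every finite-index `Γ ∋ T`.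

The matching lower bound `r ≥ [SL₂(ℤ) : Γ]` (a rank input with column weights) and the cusp and
elliptic constraints without `-1 ∈ Γ` are the sequels; the target is the dimension of `S_k(Γ₁(N))`
in odd weight. Everything is proved; no named facts.

## References

* T. Gannon, *The theory of vector-valued modular forms for the modular group*, Contrib. Math.
  Comput. Sci. 8, Springer (2014), 247–286, Thm. 3.4(a), §3.5 (representations with `ρ(-1) = -1`
  and odd weights).
* C. Marks, G. Mason, *Structure of the module of vector-valued modular forms*, J. London Math.
  Soc. (2) 82 (2010), 32–48, Thm. 1.
* J. Sturm, *On the congruence of modular forms*, LNM 1240 (1987), Thm. 1.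
-/

noncomputable section

open UpperHalfPlane hiding I
open ModularForm Complex Matrix.SpecialLinearGroup Filter Asymptotics CongruenceSubgroup
open scoped MatrixGroups Real ModularForm Topology Manifold

namespace Literature.NumberTheory.EllipticCurves.ModularForms

namespace Level

/-! ### `±Γ`: index and even weights -/

section AdjoinNegI

variable (Γ : Subgroup SL(2, ℤ))

/-- `±Γ` has finite index when `Γ` has. [folklore] -/
instance finiteIndex_adjoinNegI [Γ.FiniteIndex] : (adjoinNegI Γ).FiniteIndex :=
  Subgroup.finiteIndex_of_le (le_adjoinNegI (Γ := Γ))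

/-- `T ∈ ±Γ` when `T ∈ Γ`. [folklore] -/
instance fact_T_mem_adjoinNegI [hT : Fact (ModularGroup.T ∈ Γ)] :
    Fact (ModularGroup.T ∈ adjoinNegI Γ) :=
  ⟨le_adjoinNegI hT.out⟩

/-- `[±Γ : Γ] = 2` if `-1 ∉ Γ`. [folklore] -/
theorem relIndex_adjoinNegI_eq_two (hneg : (-1 : SL(2, ℤ)) ∉ Γ) : Γ.relIndex (adjoinNegI Γ) = 2 := by
  rw [Subgroup.relIndex, Subgroup.index_eq_two_iff]
  refine ⟨⟨-1, neg_one_mem_adjoinNegI⟩, fun b ↦ ?_⟩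
  simp only [Subgroup.mem_subgroupOf, Subgroup.coe_mul, mul_neg, mul_one]
  rcases b.2 with hb | hb
  · refine Or.inr ⟨hb, fun h ↦ hneg ?_⟩
    have := mul_mem (inv_mem hb) h
    rwa [mul_neg, inv_mul_cancel] at this
  · refine Or.inl ⟨hb, fun h ↦ hneg ?_⟩
    have := mul_mem (inv_mem h) hb
    rwa [mul_neg, inv_mul_cancel] at this

/-- **`[SL₂(ℤ) : Γ] = 2[SL₂(ℤ) : ±Γ]` if `-1 ∉ Γ`.** [folklore] -/
theorem index_eq_two_mul_of_neg_one_not_mem (hneg : (-1 : SL(2, ℤ)) ∉ Γ) :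
    Γ.index = 2 * (adjoinNegI Γ).index := by
  rw [← Subgroup.relIndex_mul_index (le_adjoinNegI (Γ := Γ)), relIndex_adjoinNegI_eq_two Γ hneg]

/-- `[SL₂(ℤ) : ±Γ] ≤ [SL₂(ℤ) : Γ]`. [folklore] -/
theorem index_adjoinNegI_le [Γ.FiniteIndex] : (adjoinNegI Γ).index ≤ Γ.index :=
  Subgroup.index_antitone (le_adjoinNegI (Γ := Γ))

/-- **`M_k(±Γ) = M_k(Γ)` for even `k`** (as spaces of functions; `slash_neg_of_even` of
`ModularFormsGamma1PlusMinus`, which is the case `Γ = Γ₁(N)`). [folklore] -/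
theorem levelSpace_adjoinNegI_eq_of_even [Γ.FiniteIndex] {k : ℤ} (hk : Even k) :
    levelSpace (adjoinNegI Γ) k = levelSpace Γ k := by
  refine le_antisymm (formSpace_mono (Subgroup.map_mono (le_adjoinNegI (Γ := Γ)))) ?_
  intro f hf
  rw [mem_formSpace_iff] at hf ⊢
  refine ⟨hf.1, ?_, hf.2.2⟩
  rintro _ ⟨γ, hγ, rfl⟩
  rcases hγ with hγ | hγ
  · exact hf.2.1 _ ⟨γ, hγ, rfl⟩
  · have h : f ∣[k] (-γ) = f := hf.2.1 _ ⟨-γ, hγ, rfl⟩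
    rw [slash_neg_of_even hk] at h
    exact h

end AdjoinNegI

/-! ### The sharp Sturm bound `dim M_k(Γ) ≤ ⌊k[SL₂(ℤ):±Γ]/12⌋ + 1` -/

section Sturm

variable (Γ : Subgroup SL(2, ℤ)) [Γ.FiniteIndex] [hT : Fact (ModularGroup.T ∈ Γ)]

/-- **Sturm's bound with the index of `±Γ`, every weight**:
`dim M_k(Γ) ≤ ⌊k[SL₂(ℤ) : ±Γ]/12⌋ + 1`. For even `k`, `M_k(Γ) = M_k(±Γ)`; for odd `k` the square of
a form whose first `⌊k[SL₂(ℤ):±Γ]/12⌋ + 1` coefficients vanish is a form on `±Γ` of weight `2k`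
vanishing at `∞` to order `> ⌊2k[SL₂(ℤ):±Γ]/12⌋`, hence zero. [cite: Sturm1987, Thm. 1] -/
theorem finrank_levelSpace_le_sharp (k : ℤ) :
    Module.finrank ℂ (levelSpace Γ k) ≤ (k * (adjoinNegI Γ).index).toNat / 12 + 1 := by
  rcases Int.even_or_odd k with hk | hk
  · rw [← levelSpace_adjoinNegI_eq_of_even Γ hk]
    exact finrank_levelSpace_le (adjoinNegI Γ) k
  · rw [finrank_formSpace]
    set μ : ℕ := (adjoinNegI Γ).index with hμ
    set B : ℕ := (k * (μ : ℤ)).toNat / 12 with hB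
    have h1 := one_mem_strictPeriods Γ
    have han : ∀ f : ModularForm Γ k, AnalyticAt ℂ (cuspFunction 1 f) 0 := fun f ↦
      ModularFormClass.analyticAt_cuspFunction_zero f one_pos h1
    -- the truncated `q`-expansion
    let L : ModularForm Γ k →ₗ[ℂ] (Fin (B + 1) → ℂ) :=
      { toFun := fun f j ↦ (qExpansion 1 f).coeff j
        map_add' := fun f g ↦ by
          funext j
          simp only [Pi.add_apply]
          rw [ModularForm.coe_add, qExpansion_add (han f) (han g), map_add]
        map_smul' := fun c f ↦ by
          funext j
          simp only [Pi.smul_apply, RingHom.id_apply, smul_eq_mul]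
          rw [ModularForm.IsGLPos.coe_smul, qExpansion_smul (han f), map_smul, smul_eq_mul] }
    have hL : Function.Injective L := by
      rw [injective_iff_map_eq_zero]
      intro f hf
      have hO := isBigO_exp_of_qExpansion_coeff_eq_zero f h1 (m := B + 1)
        (fun i hi ↦ congr_fun hf ⟨i, hi⟩)
      -- the square is a form on `±Γ`
      have hsq : (⇑f * ⇑f : ℍ → ℂ) ∈ levelSpace (adjoinNegI Γ) (k + k) := by
        rw [levelSpace_adjoinNegI_eq_of_even Γ ⟨k, rfl⟩]
        exact mul_mem_formSpace (coe_mem_formSpace f) (coe_mem_formSpace f)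
      obtain ⟨G, hG⟩ := hsq
      have hGO : (⇑G : ℍ → ℂ) =O[atImInfty]
          fun τ : ℍ ↦ Real.exp (-2 * π * ((2 * (B + 1) : ℕ) : ℝ) * τ.im) := by
        rw [hG]
        refine (hO.mul hO).congr_right fun τ ↦ ?_
        rw [← Real.exp_add]
        congr 1
        push_cast
        ring
      have hG0 : (⇑G : ℍ → ℂ) = 0 := by
        refine coe_eq_zero_of_isBigO_exp' G hGO ?_
        rw [card_quotient_subgroupOf_eq_index]
        have : ((k + k) * ((adjoinNegI Γ).index : ℤ)).toNat / 12 < 2 * (B + 1) := by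
          rw [hB, ← hμ, show (k + k) * (μ : ℤ) = 2 * (k * (μ : ℤ)) by ring]
          omega
        exact_mod_cast this
      rw [hG] at hG0
      ext τ
      have := congr_fun hG0 τ
      simp only [Pi.mul_apply, Pi.zero_apply, mul_self_eq_zero] at this
      simp [this]
    exact (LinearMap.finrank_le_finrank_of_injective hL).trans (Module.finrank_fin_fun ℂ).le

end Sturm

/-! ### At most `[SL₂(ℤ) : Γ]` generators, without `-1 ∈ Γ` -/

section Count

variable (Γ : Subgroup SL(2, ℤ)) [Γ.FiniteIndex] [hT : Fact (ModularGroup.T ∈ Γ)]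

/-- **The key inequality per parity**: for `ε ∈ {0, 1}` and all `B, L`,
`#(generators of weight ≤ B and parity ε) · L ≤ Lμ⁺ + (B + 1)μ⁺ + 1`, `μ⁺ = [SL₂(ℤ) : ±Γ]`, from
the injection `⊕_j R_{M - k_j} ↪ M_M(Γ)` over those generators (`M = 12L + 2B + ε`,
independence) against the sharp Sturm bound. [folklore] -/
theorem card_genBelow_filter_mul_le (ε : ℕ) (hε : ε < 2) (B L : ℕ) :
    ((genBelow Γ B).filter fun j ↦ j.1 % 2 = ε).card * L ≤
      L * (adjoinNegI Γ).index + (B + 1) * (adjoinNegI Γ).index + 1 := by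
  classical
  set μ : ℕ := (adjoinNegI Γ).index with hμ
  set M : ℕ := 12 * L + 2 * B + ε with hM
  set s := (genBelow Γ B).filter fun j ↦ j.1 % 2 = ε with hs
  -- the combination map
  let Ψ : (Π j : s, levelOneSpace ((M : ℤ) - (j : GenIndex Γ).wt)) →ₗ[ℂ] (ℍ → ℂ) :=
    { toFun := fun p ↦ ∑ j : s, ((p j : ℍ → ℂ)) * (j : GenIndex Γ).fn
      map_add' := fun p p' ↦ by
        simp only [Pi.add_apply, Submodule.coe_add, add_mul, Finset.sum_add_distrib]
      map_smul' := fun c p ↦ by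
        simp only [Pi.smul_apply, Submodule.coe_smul, RingHom.id_apply, Finset.smul_sum,
          smul_mul_assoc] }
  have hΨmem : ∀ p, Ψ p ∈ levelSpace Γ M := fun p ↦ by
    refine Submodule.sum_mem _ fun j _ ↦ ?_
    have := levelOne_mul_mem Γ (p j).2 (GenIndex.fn_mem Γ (j : GenIndex Γ))
    rwa [sub_add_cancel] at this
  have hΨinj : Function.Injective (Ψ.codRestrict _ hΨmem) := by
    rw [injective_iff_map_eq_zero]
    intro p hp0
    have hsum0 : ∑ j : s, ((p j : ℍ → ℂ)) * (j : GenIndex Γ).fn = 0 :=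
      congrArg Subtype.val hp0
    -- extend `p` by zero
    let P : GenIndex Γ → ℍ → ℂ := fun j ↦ if h : j ∈ s then (p ⟨j, h⟩ : ℍ → ℂ) else 0
    have hP : ∀ j, P j ∈ levelOneSpace ((M : ℤ) - j.wt) := fun j ↦ by
      by_cases h : j ∈ s
      · simp only [P, h, dif_pos]
        exact (p ⟨j, h⟩).2
      · simp only [P, h, dif_neg, not_false_eq_true]
        exact Submodule.zero_mem _
    have hsub : s ⊆ genBelow Γ (M : ℤ).toNat := by
      rw [Int.toNat_natCast]
      exact (Finset.filter_subset _ _).trans (genBelow_mono Γ (show B ≤ M by omega))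
    have hPsum : ∑ j ∈ genBelow Γ (M : ℤ).toNat, P j * j.fn = 0 := by
      rw [← Finset.sum_subset hsub (fun j _ hj ↦ by simp [P, hj])]
      rw [← hsum0, ← Finset.sum_coe_sort s]
      refine Finset.sum_congr rfl fun j _ ↦ ?_
      simp [P, j.2]
    have hP0 := coeffs_eq_zero Γ (M : ℤ) P hP hPsum
    funext j
    apply Subtype.ext
    have := hP0 j
    simp only [P, j.2, dif_pos] at this
    simpa using this
  -- dimension count
  have hdom : s.card * L ≤
      Module.finrank ℂ (Π j : s, levelOneSpace ((M : ℤ) - (j : GenIndex Γ).wt)) := by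
    have hcard : s.card * L = ∑ _i : s, L := by simp [Finset.sum_const]
    rw [Module.finrank_pi_fintype, hcard]
    refine Finset.sum_le_sum fun j _ ↦ ?_
    have hj := Finset.mem_filter.mp j.2
    have hjB : (j : GenIndex Γ).1 ≤ B := (mem_genBelow Γ).mp hj.1
    have hjε : (j : GenIndex Γ).1 % 2 = ε := hj.2
    -- `M - k_j = 2 r` with `r ≥ 6 L`
    obtain ⟨r, hr⟩ : ∃ r : ℕ, M - (j : GenIndex Γ).1 = 2 * r := ⟨(M - (j : GenIndex Γ).1) / 2, by omega⟩
    have hw : ((M : ℤ) - (j : GenIndex Γ).wt) = ((2 * r : ℕ) : ℤ) := by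
      simp only [GenIndex.wt]
      omega
    rw [hw]
    refine le_trans ?_ (le_finrank_levelOneSpace ⟨r, by ring⟩)
    omega
  have hcod : Module.finrank ℂ (levelSpace Γ M) ≤ L * μ + (B + 1) * μ + 1 := by
    refine (finrank_levelSpace_le_sharp Γ M).trans ?_
    have : ((M : ℤ) * (adjoinNegI Γ).index).toNat = M * μ := by
      rw [hμ, show ((M : ℤ) * (adjoinNegI Γ).index) = ((M * (adjoinNegI Γ).index : ℕ) : ℤ) by
        push_cast; ring]
      exact Int.toNat_natCast _
    rw [this, hM]
    have h1 : (12 * L + 2 * B + ε) * μ / 12 ≤ L * μ + (B + 1) * μ := by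
      apply Nat.div_le_of_le_mul
      nlinarith
    omega
  exact hdom.trans ((LinearMap.finrank_le_finrank_of_injective hΨinj).trans hcod)

/-- At most `[SL₂(ℤ) : ±Γ]` generators of each parity and weight `≤ B`. [folklore] -/
theorem card_genBelow_filter_le (ε : ℕ) (hε : ε < 2) (B : ℕ) :
    ((genBelow Γ B).filter fun j ↦ j.1 % 2 = ε).card ≤ (adjoinNegI Γ).index := by
  by_contra h
  push Not at h
  set μ := (adjoinNegI Γ).index
  have key := card_genBelow_filter_mul_le Γ ε hε B ((B + 1) * μ + 2)
  set L := (B + 1) * μ + 2 with hL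
  have h1 : (μ + 1) * L ≤ L * μ + (B + 1) * μ + 1 := (Nat.mul_le_mul_right L h).trans key
  rw [Nat.succ_mul, mul_comm L μ] at h1
  omega

/-- **At most `[SL₂(ℤ) : Γ]` generators** of weight `≤ B`, for every `B` and every finite-index
`Γ ∋ T` (no hypothesis on `-1`): `[SL₂(ℤ):±Γ]` of each parity if `-1 ∉ Γ`
(`[SL₂(ℤ):Γ] = 2[SL₂(ℤ):±Γ]`), and no odd ones if `-1 ∈ Γ`. [folklore] -/
theorem card_genBelow_le' (B : ℕ) : (genBelow Γ B).card ≤ Γ.index := by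
  classical
  have hsplit : (genBelow Γ B).card =
      ((genBelow Γ B).filter fun j ↦ j.1 % 2 = 0).card +
        ((genBelow Γ B).filter fun j ↦ j.1 % 2 = 1).card := by
    have : ((genBelow Γ B).filter fun j ↦ ¬ (j.1 % 2 = 0)) =
        (genBelow Γ B).filter fun j ↦ j.1 % 2 = 1 :=
      Finset.filter_congr fun j _ ↦ by omega
    rw [← this]
    exact (Finset.card_filter_add_card_filter_not _).symm
  have h0 := card_genBelow_filter_le Γ 0 (by norm_num) B
  have h1 := card_genBelow_filter_le Γ 1 (by norm_num) B
  by_cases hneg : (-1 : SL(2, ℤ)) ∈ Γ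
  · -- no odd generators, `±Γ = Γ`
    have hodd : ((genBelow Γ B).filter fun j ↦ j.1 % 2 = 1).card = 0 := by
      rw [Finset.card_eq_zero, Finset.filter_eq_empty_iff]
      intro j _ hj
      have := numGen_eq_zero_of_odd Γ hneg (Nat.odd_iff.mpr hj)
      have h2 : (j.2 : ℕ) < numGen Γ j.1 := j.2.2
      omega
    rw [adjoinNegI_eq_self_of_neg_one_mem hneg] at h0
    omega
  · rw [index_eq_two_mul_of_neg_one_not_mem Γ hneg]
    omega

/-- The generators have bounded weight. [folklore] -/
theorem exists_fst_le' : ∃ K₀ : ℕ, ∀ j : GenIndex Γ, j.1 ≤ K₀ := by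
  classical
  set S : Set ℕ := {k | numGen Γ k ≠ 0} with hS
  have hSfin : S.Finite := by
    by_contra hinf
    obtain ⟨T, hTS, hTcard⟩ := Set.Infinite.exists_subset_card_eq hinf (Γ.index + 1)
    set B := T.sup id
    have h1 : T.card ≤ ∑ k ∈ T, numGen Γ k := by
      rw [Finset.card_eq_sum_ones]
      exact Finset.sum_le_sum fun k hk ↦ Nat.one_le_iff_ne_zero.mpr (hTS hk)
    have h2 : ∑ k ∈ T, numGen Γ k ≤ (genBelow Γ B).card := by
      rw [genBelow, Finset.card_sigma]
      simp only [Finset.card_univ, Fintype.card_fin]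
      refine Finset.sum_le_sum_of_subset fun k hk ↦ ?_
      exact Finset.mem_range.mpr (Nat.lt_succ_of_le (Finset.le_sup (f := id) hk))
    have h3 := card_genBelow_le' Γ B
    omega
  refine ⟨hSfin.toFinset.sup id, fun j ↦ ?_⟩
  have hj : j.1 ∈ hSfin.toFinset := by
    rw [Set.Finite.mem_toFinset]
    exact Nat.pos_iff_ne_zero.mp j.2.pos
  exact Finset.le_sup (f := id) hj

/-- **A level-one basis of `M(Γ)` for every finite-index `Γ ∋ T`**: `M(Γ) = ⊕ₖ M_k(Γ)` is a free
`ℂ[E₄, E₆]`-module on `r ≤ [SL₂(ℤ) : Γ]` homogeneous generators of weights `≥ 0` (of both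
parities when `-1 ∉ Γ`). [cite: Gannon2014, Thm. 3.4(a)] -/
theorem exists_isLevelBasis' : ∃ (r : ℕ) (wt : Fin r → ℤ) (F : Fin r → ℍ → ℂ),
    IsLevelBasis Γ wt F ∧ r ≤ Γ.index ∧ ∀ i, 0 ≤ wt i := by
  classical
  obtain ⟨K₀, hK₀⟩ := exists_fst_le' Γ
  set s := genBelow Γ K₀ with hs
  have hall : ∀ m, K₀ ≤ m → genBelow Γ m = s := fun m hm ↦ by
    ext j
    simp only [mem_genBelow, hs]
    exact ⟨fun _ ↦ hK₀ j, fun _ ↦ (hK₀ j).trans hm⟩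
  have hsum : ∀ (m : ℤ) (p : GenIndex Γ → ℍ → ℂ), (∀ j, p j ∈ levelOneSpace (m - j.wt)) →
      ∑ j ∈ genBelow Γ m.toNat, p j * j.fn = ∑ j ∈ s, p j * j.fn := by
    intro m p hp
    rcases le_or_gt K₀ m.toNat with h | h
    · rw [hall _ h]
    · exact (sum_genBelow_eq Γ h.le hp).symm
  set r := s.card
  let e : Fin r ≃ s := s.equivFin.symm
  refine ⟨r, fun i ↦ (e i : GenIndex Γ).wt, fun i ↦ (e i : GenIndex Γ).fn, ⟨fun i ↦ ?_, ?_, ?_⟩,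
    card_genBelow_le' Γ K₀, fun i ↦ GenIndex.wt_nonneg Γ _⟩
  · exact GenIndex.fn_mem Γ _
  · intro m f hf
    obtain ⟨p, hp, hf⟩ := exists_coeffs Γ m hf
    refine ⟨fun i ↦ p (e i), fun i ↦ hp _, ?_⟩
    rw [hf, hsum m p hp, ← Finset.sum_coe_sort s, ← e.sum_comp]
  · intro m p hp h0 i
    let P : GenIndex Γ → ℍ → ℂ := fun j ↦ if h : j ∈ s then p (e.symm ⟨j, h⟩) else 0
    have hP : ∀ j, P j ∈ levelOneSpace (m - j.wt) := fun j ↦ by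
      by_cases h : j ∈ s
      · simp only [P, h, dif_pos]
        have := hp (e.symm ⟨j, h⟩)
        simpa using this
      · simp only [P, h, dif_neg, not_false_eq_true]
        exact Submodule.zero_mem _
    have hPsum : ∑ j ∈ genBelow Γ m.toNat, P j * j.fn = 0 := by
      rw [hsum m P hP, ← Finset.sum_coe_sort s, ← e.sum_comp, ← h0]
      refine Finset.sum_congr rfl fun i _ ↦ ?_
      simp [P, (e i).2]
    have := coeffs_eq_zero Γ m P hP hPsum (e i)
    simpa [P, (e i).2] using this

end Count

end Level

end Literature.NumberTheory.EllipticCurves.ModularForms
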